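import Summits.Ventures.PercRepro.S1CoreLPToolsFree

/-!
# PercRepro — THE COLOOP-FREE PART OF A SET AND THE NULLITY CLASSES BY ITS SIZE (p2, gen 30; the level-5
coloop/closure LP, SUBCLAIM-S2 feeder)

For a set `S` of a matroid, its «coloops» are the `x ∈ S` with `ρ(S ∖ x) + 1 = ρ(S)` and its CORE is `S` minus
its coloops. The core is coloop-free, has the same nullity as `S`, and every `k`-set of nullity `ν` is its core
(a coloop-free set of nullity `ν` and some size `s`) plus `k − s` further points — so the `k`-sets of nullity `ν`
split into classes by the size `s` of their core, and the class of size `s` has at most `#(coloop-free sets of size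
`s` and nullity `ν`)·C(n − s, k − s)` members. These classes refine the rank classes `m[k, r]` of the level-4 LP
(`S1CoreLPTools`): the coloop count of a class is EXACTLY `k − s`. Nothing is claimed about any cell.

* `coloopsOf`, `core`, `nuSets`; `coloopsOf_subset`, `notMem_closure_of_mem_coloopsOf`, `eRk_core_add_ncard_coloopsOf`,
  `ncard_core_add_ncard_coloopsOf`, `coloopsOf_core_eq_empty`, `core_core`, `core_mem_nuSets`,
  `ncard_nuSets_le_mul_choose` (the extension bound), `nuSets_eq_empty_of_lt` (the size floor from the coloop counts).
Axioms: standard.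
-/

open scoped Matroid

namespace PercRepro

namespace S2LP

open Set

variable {α : Type} {M : Matroid α} [M.Finite]

/-- The coloops of a set `S`: the `x ∈ S` with `ρ(S ∖ x) + 1 = ρ(S)`. -/
def coloopsOf (M : Matroid α) (S : Set α) : Set α := {x ∈ S | M.eRk (S \ {x}) + 1 = M.eRk S}

/-- The core of a set: `S` minus its coloops. -/
def core (M : Matroid α) (S : Set α) : Set α := S \ coloopsOf M S

/-- The `k`-sets of nullity `ν` (rank `k − ν`) whose core has `s` elements. -/
def nuSets (M : Matroid α) (k ν s : ℕ) : Set (Set α) :=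
  {S : Set α | S ∈ S1.rkSets M k (k - ν) ∧ (core M S).ncard = s}

omit [M.Finite] in
/-- The coloops of `S` lie in `S`. -/
theorem coloopsOf_subset (S : Set α) : coloopsOf M S ⊆ S := fun _ hx => hx.1

omit [M.Finite] in
/-- The rank of a finite set is finite. -/
theorem eRk_ne_top_of_finite' {X : Set α} (hX : X.Finite) : M.eRk X ≠ ⊤ :=
  ne_top_of_le_ne_top hX.encard_lt_top.ne (M.eRk_le_encard X)

omit [M.Finite] in
/-- The core of `S` lies in `S`. -/
theorem core_subset (S : Set α) : core M S ⊆ S := sdiff_subset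

omit [M.Finite] in
/-- Membership in `nuSets`. -/
theorem mem_nuSets {k ν s : ℕ} {S : Set α} :
    S ∈ nuSets M k ν s ↔ (S ⊆ M.E ∧ S.ncard = k ∧ M.eRk S = ((k - ν : ℕ) : ℕ∞)) ∧ (core M S).ncard = s :=
  Iff.rfl

/-- The classes are finite. -/
theorem nuSets_finite (k ν s : ℕ) : (nuSets M k ν s).Finite :=
  (S1.rkSets_finite k (k - ν)).subset (fun _ h => h.1)

/-- A coloop of a finite-rank set lies outside the closure of the rest. -/
theorem notMem_closure_of_mem_coloopsOf {S : Set α} (hS : S ⊆ M.E) {x : α} (hx : x ∈ coloopsOf M S) :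
    x ∉ M.closure (S \ {x}) := by
  intro hmem
  have hsub : S ⊆ M.closure (S \ {x}) := by
    intro y hy
    by_cases hyx : y = x
    · rw [hyx]; exact hmem
    · exact M.subset_closure (S \ {x}) (sdiff_subset.trans hS) ⟨hy, hyx⟩
  have h1 : M.eRk S ≤ M.eRk (S \ {x}) := by
    calc M.eRk S ≤ M.eRk (M.closure (S \ {x})) := M.eRk_mono hsub
      _ = M.eRk (S \ {x}) := M.eRk_closure_eq _
  have h2 := hx.2
  have hfin : M.eRk (S \ {x}) ≠ ⊤ :=
    eRk_ne_top_of_finite' (M.ground_finite.subset (sdiff_subset.trans hS))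
  obtain ⟨a, ha⟩ := ENat.ne_top_iff_exists.mp hfin
  rw [← ha] at h1 h2
  rw [← h2] at h1
  have : a + 1 ≤ a := by exact_mod_cast h1
  omega

/-- Removing the coloops lowers the rank by their number: `ρ(core S) + #coloops = ρ(S)`. -/
theorem eRk_core_add_encard_coloopsOf {S : Set α} (hS : S ⊆ M.E) :
    M.eRk (core M S) + (coloopsOf M S).encard = M.eRk S :=
  S1.eRk_sdiff_add_encard_of_forall_notMem_closure (coloopsOf_subset S)
    ((M.ground_finite.subset hS).subset (coloopsOf_subset S))
    (fun _ hx => ⟨hS hx.1, notMem_closure_of_mem_coloopsOf hS hx⟩)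

/-- `#core S + #coloops S = #S`. -/
theorem ncard_core_add_ncard_coloopsOf {S : Set α} (hS : S ⊆ M.E) :
    (core M S).ncard + (coloopsOf M S).ncard = S.ncard :=
  ncard_sdiff_add_ncard_of_subset (coloopsOf_subset S) (M.ground_finite.subset hS)

/-- The coloops of `S` stay outside the closure of any subset of `S ∖ x`: adding them to a subset `T ⊆ core S`
raises the rank by their number. -/
theorem eRk_union_coloopsOf {S T : Set α} (hS : S ⊆ M.E) (hT : T ⊆ core M S) :
    M.eRk (T ∪ coloopsOf M S) = M.eRk T + (coloopsOf M S).encard := by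
  have hCfin : (coloopsOf M S).Finite := (M.ground_finite.subset hS).subset (coloopsOf_subset S)
  have h := S1.eRk_sdiff_add_encard_of_forall_notMem_closure (M := M) (S := T ∪ coloopsOf M S)
    (C := coloopsOf M S) subset_union_right hCfin (fun x hx => by
      refine ⟨hS hx.1, fun hmem => notMem_closure_of_mem_coloopsOf hS hx ?_⟩
      refine M.closure_subset_closure ?_ hmem
      intro y hy
      rcases hy with ⟨hy | hy, hyx⟩
      · exact ⟨(hT hy).1, hyx⟩
      · exact ⟨hy.1, hyx⟩)
  have hTC : (T ∪ coloopsOf M S) \ coloopsOf M S = T := by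
    rw [union_sdiff_right]
    exact sdiff_eq_left.mpr (disjoint_left.mpr (fun y hy hyC => (hT hy).2 hyC))
  rw [hTC] at h
  exact h.symm

/-- **The core is coloop-free.** -/
theorem coloopsOf_core_eq_empty {S : Set α} (hS : S ⊆ M.E) : coloopsOf M (core M S) = ∅ := by
  ext x
  simp only [mem_empty_iff_false, iff_false]
  rintro ⟨hx, hrk⟩
  -- `x ∈ core S`: `x ∈ S`, `x` not a coloop of `S`
  have hxS : x ∈ S := hx.1
  have hxC : x ∉ coloopsOf M S := hx.2
  have hCfin : (coloopsOf M S).Finite := (M.ground_finite.subset hS).subset (coloopsOf_subset S)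
  -- `S ∖ x = (core S ∖ x) ∪ coloops S`
  have hdecomp : S \ {x} = (core M S \ {x}) ∪ coloopsOf M S := by
    ext y
    simp only [mem_sdiff, mem_singleton_iff, mem_union, core]
    constructor
    · rintro ⟨hyS, hyx⟩
      by_cases hyC : y ∈ coloopsOf M S
      · exact Or.inr hyC
      · exact Or.inl ⟨⟨hyS, hyC⟩, hyx⟩
    · rintro (⟨⟨hyS, -⟩, hyx⟩ | hyC)
      · exact ⟨hyS, hyx⟩
      · refine ⟨hyC.1, fun hyx => hxC ?_⟩
        rw [← hyx]; exact hyC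
  have hS' : S = core M S ∪ coloopsOf M S := by
    ext y
    simp only [mem_union, core, mem_sdiff]
    constructor
    · intro hy
      by_cases hyC : y ∈ coloopsOf M S
      · exact Or.inr hyC
      · exact Or.inl ⟨hy, hyC⟩
    · rintro (⟨hy, -⟩ | hyC)
      · exact hy
      · exact hyC.1
  have h1 := eRk_union_coloopsOf hS (T := core M S \ {x}) sdiff_subset
  have h2 := eRk_union_coloopsOf hS (T := core M S) subset_rfl
  rw [← hdecomp] at h1
  rw [← hS'] at h2
  -- `x` is not a coloop of `S`: `ρ(S ∖ x) = ρ(S)`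
  have hnot : ¬ (M.eRk (S \ {x}) + 1 = M.eRk S) := fun h => hxC ⟨hxS, h⟩
  have hle : M.eRk (S \ {x}) ≤ M.eRk S := M.eRk_mono sdiff_subset
  have hfinS : M.eRk S ≠ ⊤ := eRk_ne_top_of_finite' (M.ground_finite.subset hS)
  have hge : M.eRk S ≤ M.eRk (S \ {x}) + 1 := by
    have := M.eRk_insert_le_add_one x (S \ {x})
    rwa [insert_sdiff_singleton, insert_eq_of_mem hxS] at this
  obtain ⟨a, ha⟩ := ENat.ne_top_iff_exists.mp hfinS
  have hfin' : M.eRk (S \ {x}) ≠ ⊤ := ne_top_of_le_ne_top hfinS hle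
  obtain ⟨b, hb⟩ := ENat.ne_top_iff_exists.mp hfin'
  have heq : M.eRk (S \ {x}) = M.eRk S := by
    rw [← ha, ← hb] at hle hge hnot ⊢
    have h1' : b ≤ a := by exact_mod_cast hle
    have h2' : a ≤ b + 1 := by exact_mod_cast hge
    have h3' : ¬ (b + 1 = a) := fun h => hnot (by exact_mod_cast h)
    have : a = b := by omega
    rw [this]
  -- hence `ρ(core S ∖ x) = ρ(core S)`, contradicting `hrk`
  rw [heq, h2] at h1
  have hCfin' : (coloopsOf M S).encard ≠ ⊤ := hCfin.encard_lt_top.ne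
  have h3 : M.eRk (core M S \ {x}) = M.eRk (core M S) :=
    (WithTop.add_right_cancel hCfin' h1).symm
  rw [h3] at hrk
  have hfinc : M.eRk (core M S) ≠ ⊤ :=
    eRk_ne_top_of_finite' ((M.ground_finite.subset hS).subset (core_subset S))
  obtain ⟨c, hc⟩ := ENat.ne_top_iff_exists.mp hfinc
  rw [← hc] at hrk
  have : c + 1 = c := by exact_mod_cast hrk
  omega

/-- `core (core S) = core S`. -/
theorem core_core {S : Set α} (hS : S ⊆ M.E) : core M (core M S) = core M S := by
  unfold core
  rw [show coloopsOf M (S \ coloopsOf M S) = ∅ from coloopsOf_core_eq_empty hS, sdiff_empty]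

/-- **The core of a `k`-set of nullity `ν` with core size `s` is an `s`-set of nullity `ν` with core size `s`.** -/
theorem core_mem_nuSets {k ν s : ℕ} (hνk : ν ≤ k) {S : Set α} (hS : S ∈ nuSets M k ν s) :
    core M S ∈ nuSets M s ν s := by
  obtain ⟨⟨hSE, hSk, hSr⟩, hcore⟩ := hS
  have hCE : core M S ⊆ M.E := (core_subset S).trans hSE
  refine ⟨⟨hCE, hcore, ?_⟩, ?_⟩
  · have h1 := eRk_core_add_encard_coloopsOf (M := M) hSE
    have h2 := ncard_core_add_ncard_coloopsOf (M := M) hSE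
    have hCfin : (coloopsOf M S).Finite := (M.ground_finite.subset hSE).subset (coloopsOf_subset S)
    rw [← hCfin.cast_ncard_eq, hSr] at h1
    have hfinc : M.eRk (core M S) ≠ ⊤ := eRk_ne_top_of_finite' (M.ground_finite.subset hCE)
    obtain ⟨c, hc⟩ := ENat.ne_top_iff_exists.mp hfinc
    rw [← hc] at h1 ⊢
    have h1' : c + (coloopsOf M S).ncard = k - ν := by exact_mod_cast h1
    have : c = s - ν := by omega
    rw [this]
  · rw [core_core hSE, hcore]

/-- The `(k − s)`-subsets of `E ∖ T` for a finite `T ⊆ E` of `s` elements number `C(n − s, k − s)`. -/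
theorem ncard_subsets_compl {T : Set α} (hT : T ⊆ M.E) {s : ℕ} (hs : T.ncard = s) (j : ℕ) :
    {R : Set α | R ⊆ M.E \ T ∧ R.ncard = j}.ncard = (M.E.ncard - s).choose j := by
  rw [S1.ncard_setOf_subset_ncard_eq (M.ground_finite.subset sdiff_subset) j,
    ncard_sdiff' hT M.ground_finite, hs]

/-- **THE EXTENSION BOUND**: `#nuSets k ν s ≤ #nuSets s ν s · C(n − s, k − s)` — a `k`-set of nullity `ν` with core
size `s` is its core plus `k − s` points outside it. -/
theorem ncard_nuSets_le_mul_choose {k ν s : ℕ} (hνk : ν ≤ k) :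
    (nuSets M k ν s).ncard ≤ (nuSets M s ν s).ncard * (M.E.ncard - s).choose (k - s) := by
  rw [mul_comm]
  refine S1.ncard_le_mul_of_fibres (nuSets_finite s ν s)
    (fun T => {S ∈ nuSets M k ν s | core M S = T}) ?_ (fun T _ => (nuSets_finite k ν s).subset (fun _ h => h.1))
    ((M.E.ncard - s).choose (k - s)) ?_
  · intro S hS
    rw [mem_iUnion₂]
    exact ⟨core M S, core_mem_nuSets hνk hS, hS, rfl⟩
  · rintro T ⟨⟨hTE, hTs, -⟩, -⟩
    -- the fibre over `T` injects into the `(k − s)`-subsets of `E ∖ T` by `S ↦ S ∖ T`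
    have hinj : Set.InjOn (fun S : Set α => S \ T) {S ∈ nuSets M k ν s | core M S = T} := by
      rintro S₁ ⟨hS₁, hc₁⟩ S₂ ⟨hS₂, hc₂⟩ heq
      have e1 : S₁ = (S₁ \ T) ∪ T := by
        have hTS : T ⊆ S₁ := by rw [← hc₁]; exact core_subset S₁
        rw [sdiff_union_of_subset hTS]
      have e2 : S₂ = (S₂ \ T) ∪ T := by
        have hTS : T ⊆ S₂ := by rw [← hc₂]; exact core_subset S₂
        rw [sdiff_union_of_subset hTS]
      rw [e1, e2]
      simp only at heq
      rw [heq]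
    have hsub : (fun S : Set α => S \ T) '' {S ∈ nuSets M k ν s | core M S = T} ⊆
        {R : Set α | R ⊆ M.E \ T ∧ R.ncard = k - s} := by
      rintro R ⟨S, ⟨⟨⟨hSE, hSk, -⟩, -⟩, hcS⟩, rfl⟩
      refine ⟨fun y hy => ⟨hSE hy.1, hy.2⟩, ?_⟩
      have hTS : T ⊆ S := by rw [← hcS]; exact core_subset S
      rw [ncard_sdiff' hTS (M.ground_finite.subset hSE), hSk, hTs]
    calc {S ∈ nuSets M k ν s | core M S = T}.ncard
        = ((fun S : Set α => S \ T) '' {S ∈ nuSets M k ν s | core M S = T}).ncard :=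
          (hinj.ncard_image).symm
      _ ≤ {R : Set α | R ⊆ M.E \ T ∧ R.ncard = k - s}.ncard :=
          ncard_le_ncard hsub ((M.ground_finite.subset sdiff_subset).finite_subsets.subset (fun _ h => h.1))
      _ = (M.E.ncard - s).choose (k - s) := ncard_subsets_compl hTE hTs (k - s)

end S2LP

end PercRepro
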